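import Mathlib.Computability.Halting
import Literature.Computability.Cryptography.PolyTimeComputableRealsComputable
import Literature.Computability.Complexity.Nondeterministic
import HarnessLib

/-!
# Machine-computable functions are partial recursive; `P` and `NP` languages are decidable predicates

A bridge between the two models of computation living in the tree: Mathlib's stack machines
`Turing.FinTM2` (the base of `TimeComputable` / `TimeDecidable` / `DTIME` / `P` / `NP`,
`TimeBounds.lean`, `Classes.lean`, `Nondeterministic.lean`) and Mathlib's partial recursive
functions (`Partrec`, `Computable`, `ComputablePred`). Companion of
`PolyTimeComputableRealsComputable.lean` (`PolyTimeComputable.exists_primrec`: with a POLYNOMIAL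
clock the simulation is primitive recursive); here the time bound `t` is arbitrary (it need not be
recursive), so the halting time is found by unbounded search (`Nat.rfind`) on the primitive
recursive interpreter `UnivTM2.urun` (`UniversalTM2.lean`) — Kleene's normal form for `TM2`
machines (Arora–Barak 2009, §1.4, Thm. 1.9: the universal machine simulates `M` step by step and
halts when `M` halts):

* `UnivTM2.outBits_urun_idxOf_of_le` — the interpreter, run for any number `m' ≥` halting time of
  steps, returns the machine's output word; `UnivTM2.urun_initCfg_fst_isSome_of_lt` — before the
  halting time the coded configuration carries a label (is not halted);
* `UnivTM2.exists_partrec_run` — hence for every machine `T` (Boolean alphabets) there is a partial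
  recursive `F : List Bool →. List Bool` with `y ∈ F w` whenever `T` outputs `y` on `w`;
* `TimeComputable.exists_partrec`, `TimeComputable.computable_encode` — every `TimeComputable ea eb f t`
  (any `t`) is partial recursive on codes, and `a ↦ eb (f a)` is `Computable` for a computable
  input coding;
* `TimeDecidable.computablePred_mem`, `computablePred_mem_of_mem_DTIME`, `computablePred_mem_of_mem_P`
  — languages in `DTIME t`, `P` are `ComputablePred` (Sipser 2012, Def. 7.7/7.12: time classes
  consist of languages decided by DECIDERS; Arora–Barak 2009, Def. 1.13);
* `computablePred_mem_of_mem_NP` — so are `NP` languages: search all certificates of length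
  `≤ p(|x|)` (Arora–Barak 2009, Claim 2.4 proof, "enumerate all possible `u`"; Sipser 2012,
  Thm. 7.27 area / §7.3 "NP ⊆ EXPTIME": every `NP` language is decidable).

Everything here is proved; no definition and no named fact is introduced.

## References

* S. Arora, B. Barak, *Computational Complexity: A Modern Approach*, CUP 2009, §1.4 (Thm. 1.9,
  universal simulation), Def. 1.13, Claim 2.4 (`P ⊆ NP ⊆ EXP`, brute force over certificates)
  [AroraBarakCC2009].
* M. Sipser, *Introduction to the Theory of Computation*, 3rd ed., 2012, Def. 7.7, Def. 7.12, §7.3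
  (`NP ⊆ EXPTIME`) [Sipser2012].
-/

namespace Literature.Computability.Complexity

/-! ### Iterated partial steps -/

section Iterate

variable {σ : Type*}

/-- A run that has stopped stays stopped. [folklore] -/
private theorem iterate_bind_none (f : σ → Option σ) : ∀ k : ℕ, (flip bind f)^[k] none = none
  | 0 => rfl
  | k + 1 => by rw [Function.iterate_succ_apply]; exact iterate_bind_none f k

/-- Every prefix of a successful run is successful. [folklore] -/
private theorem iterate_bind_isSome_of_le (f : σ → Option σ) (a b : σ) {N : ℕ}
    (h : (flip bind f)^[N] (some a) = some b) {n : ℕ} (hn : n ≤ N) :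
    ∃ d, (flip bind f)^[n] (some a) = some d := by
  cases hd : (flip bind f)^[n] (some a) with
  | some d => exact ⟨d, rfl⟩
  | none =>
    exfalso
    obtain ⟨k, rfl⟩ := Nat.exists_eq_add_of_le hn
    rw [add_comm, Function.iterate_add_apply, hd, iterate_bind_none] at h
    exact Option.some_ne_none b h.symm

/-- Strictly before the end of a successful run the current state still steps. [folklore] -/
private theorem step_ne_none_of_lt (f : σ → Option σ) (a b : σ) {N : ℕ}
    (h : (flip bind f)^[N] (some a) = some b) {n : ℕ} (hn : n < N) {d : σ}
    (hd : (flip bind f)^[n] (some a) = some d) : f d ≠ none := by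
  intro hfd
  obtain ⟨k, rfl⟩ := Nat.exists_eq_add_of_lt hn
  rw [show n + k + 1 = (k + 1) + n by ring, Function.iterate_add_apply, hd,
    Function.iterate_succ_apply] at h
  change (flip bind f)^[k] (f d) = some b at h
  rw [hfd, iterate_bind_none] at h
  exact Option.some_ne_none b h.symm

end Iterate

namespace UnivTM2

open _root_.Computability Encodable Turing TM2Std Function

/-! ### The interpreter run for an arbitrary number of steps -/

/-- **The interpreter reproduces the output word**, run for any number of steps beyond the halting
time: if `T` outputs `y` on `w` within `m` steps and `m ≤ m'`, then `m'` interpreter steps on the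
coded initial configuration of `w` followed by `outBits` give `y`.
[cite: AroraBarakCC2009, §1.4 (Thm. 1.9, universal simulation)] -/
theorem outBits_urun_idxOf_of_le (T : TM2ComputableAux Bool Bool) (cc dd : ℕ) (w y : List Bool)
    {m m' : ℕ} (h : T.OutputsWithin w y m) (hm : m ≤ m') :
    outBits (idxOf T cc dd) (urun (idxOf T cc dd).prog (initCfg (idxOf T cc dd) w) m') = y := by
  obtain ⟨h1, h2⟩ := TM2Std.outputs_tr T.tm h
  have key := urun_of_outputsInTime (TM2Std.stdCode T.tm) h1 hm
  have hin : (TM2Std.stkCode T.tm T.tm.k₀ (w.map T.inputAlphabet.symm)).map Fin.val =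
      w.map (inpCode (idxOf T cc dd).io) := by
    simp only [TM2Std.stkCode, List.map_map]
    refine List.map_congr_left fun b _ => ?_
    cases b <;> rfl
  change outBits (idxOf T cc dd) (urun (encProg (TM2Std.stdCode T.tm))
    (some ((TM2Std.stdCode T.tm).main : ℕ), ((TM2Std.stdCode T.tm).init : ℕ),
      (List.replicate (TM2Std.stdCode T.tm).nK []).set (TM2Std.stdCode T.tm).k₀
        (w.map (inpCode (idxOf T cc dd).io))) m') = y
  rw [← hin, key]
  unfold outBits
  change (((List.replicate (TM2Std.stdCode T.tm).nK ([] : List ℕ)).set (TM2Std.stdCode T.tm).k₁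
      ((TM2Std.stkCode T.tm T.tm.k₁ (y.map T.outputAlphabet.symm)).map Fin.val)).getD
        (TM2Std.stdCode T.tm).k₁ []).map (fun j => (idxOf T cc dd).outTab.getD j false) = y
  rw [getD_set_replicate]
  simp only [TM2Std.stkCode, List.map_map]
  conv_rhs => rw [← List.map_id y]
  refine List.map_congr_left fun b hb => ?_
  have hallowed := h2 (T.outputAlphabet.symm b) (List.mem_map.2 ⟨b, hb, rfl⟩)
  change (List.ofFn fun j : Fin (TM2Std.stdN T.tm + 1) =>
      ((TM2Std.decOpt T.tm T.tm.k₁ (some j)).map T.outputAlphabet).getD false).getD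
        (TM2Std.enc T.tm ⟨T.tm.k₁, T.outputAlphabet.symm b⟩ : ℕ) false = b
  rw [getD_ofFn, TM2Std.decOpt_enc T.tm hallowed]
  simp

/-- The coded initial configuration of `initCfg` is the code of the standard machine's initial
configuration on the coded input word. [folklore] -/
private theorem initCfg_idxOf_eq (T : TM2ComputableAux Bool Bool) (cc dd : ℕ) (w : List Bool) :
    initCfg (idxOf T cc dd) w =
      encCfg (initList (TM2Std.stdCode T.tm).tm
        (TM2Std.stkCode T.tm T.tm.k₀ (w.map T.inputAlphabet.symm))) := by
  rw [encCfg_initList]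
  have hin : (TM2Std.stkCode T.tm T.tm.k₀ (w.map T.inputAlphabet.symm)).map Fin.val =
      w.map (inpCode (idxOf T cc dd).io) := by
    simp only [TM2Std.stkCode, List.map_map]
    refine List.map_congr_left fun b _ => ?_
    cases b <;> rfl
  rw [hin]
  rfl

/-- **Before the halting time the interpreter has not halted**: if the standard machine of `T`
reaches its halting configuration on the coded input in exactly `N` steps, then after `n < N`
interpreter steps the coded configuration still carries a label.
[cite: AroraBarakCC2009, §1.4 (Thm. 1.9, universal simulation)] -/
theorem urun_initCfg_fst_isSome_of_lt (T : TM2ComputableAux Bool Bool) (cc dd : ℕ) (w : List Bool)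
    {L' : List (Fin ((TM2Std.stdCode T.tm).N + 1))} {N : ℕ}
    (hev : (flip bind (TM2Std.stdCode T.tm).tm.step)^[N]
      (some (initList (TM2Std.stdCode T.tm).tm (TM2Std.stkCode T.tm T.tm.k₀ (w.map T.inputAlphabet.symm)))) =
      some (haltList (TM2Std.stdCode T.tm).tm L'))
    {n : ℕ} (hn : n < N) :
    (urun (idxOf T cc dd).prog (initCfg (idxOf T cc dd) w) n).1.isSome = true := by
  set c := TM2Std.stdCode T.tm
  obtain ⟨d, hd⟩ := iterate_bind_isSome_of_le c.tm.step _ _ hev hn.le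
  have hstep := step_ne_none_of_lt c.tm.step _ _ hev hn hd
  rw [initCfg_idxOf_eq]
  change (urun (encProg c) _ n).1.isSome = true
  rw [urun_of_iterate c n _ d hd]
  obtain ⟨l, v, S⟩ := d
  cases l with
  | none => exact absurd rfl hstep
  | some q => rfl

/-- **At the halting time the interpreter has halted with the output.** [cite: AroraBarakCC2009, §1.4 (Thm. 1.9, universal simulation)] -/
private theorem urun_initCfg_fst_eq_none (T : TM2ComputableAux Bool Bool) (cc dd : ℕ) (w : List Bool)
    {L' : List (Fin ((TM2Std.stdCode T.tm).N + 1))} {N : ℕ}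
    (hev : (flip bind (TM2Std.stdCode T.tm).tm.step)^[N]
      (some (initList (TM2Std.stdCode T.tm).tm (TM2Std.stkCode T.tm T.tm.k₀ (w.map T.inputAlphabet.symm)))) =
      some (haltList (TM2Std.stdCode T.tm).tm L')) :
    (urun (idxOf T cc dd).prog (initCfg (idxOf T cc dd) w) N).1 = none := by
  set c := TM2Std.stdCode T.tm
  rw [initCfg_idxOf_eq]
  change (urun (encProg c) _ N).1 = none
  rw [urun_of_iterate c N _ _ hev, encCfg_haltList]

/-- The halting test `(D, w, n) ↦ [the coded configuration after n steps has no label]` is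
primitive recursive. [cite: AroraBarakCC2009, §1.4 (Thm. 1.9, universal simulation)] -/
theorem primrec_urun_halted : Primrec (fun p : Idx × List Bool × ℕ =>
    !(urun p.1.prog (initCfg p.1 p.2.1) p.2.2).1.isSome) := by
  have hrun : Primrec (fun p : Idx × List Bool × ℕ => urun p.1.prog (initCfg p.1 p.2.1) p.2.2) :=
    primrec_urun (Idx.primrec_prog.comp Primrec.fst)
      (primrec_initCfg.comp Primrec.fst (Primrec.fst.comp Primrec.snd)) (Primrec.snd.comp Primrec.snd)
  exact Primrec.not.comp (Primrec.option_isSome.comp (Primrec.fst.comp hrun))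

/-- The clock-free output reader `(D, w, n) ↦ outBits D (urun D.prog (initCfg D w) n)` is primitive
recursive. [cite: AroraBarakCC2009, §1.4 (Thm. 1.9, universal simulation)] -/
theorem primrec_outBits_urun_steps : Primrec (fun p : Idx × List Bool × ℕ =>
    outBits p.1 (urun p.1.prog (initCfg p.1 p.2.1) p.2.2)) := by
  refine primrec_outBits.comp Primrec.fst ?_
  exact primrec_urun (Idx.primrec_prog.comp Primrec.fst)
    (primrec_initCfg.comp Primrec.fst (Primrec.fst.comp Primrec.snd)) (Primrec.snd.comp Primrec.snd)

/-- **Every machine is simulated by a partial recursive function** (Kleene normal form for `TM2`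
machines with Boolean alphabets): search the halting time of the interpreter by `Nat.rfind`, then
read the output stack. Whenever `T` outputs `y` on `w` (within any number of steps), `y ∈ F w`.
[cite: AroraBarakCC2009, §1.4 (Thm. 1.9, universal simulation)] -/
theorem exists_partrec_run (T : TM2ComputableAux Bool Bool) :
    ∃ F : List Bool →. List Bool, Partrec F ∧ ∀ w y m, T.OutputsWithin w y m → y ∈ F w := by
  set D := idxOf T 0 0 with hD
  refine ⟨fun w => (Nat.rfind fun n => Part.some (!(urun D.prog (initCfg D w) n).1.isSome)).map
      fun n => outBits D (urun D.prog (initCfg D w) n), ?_, ?_⟩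
  · refine Partrec.map (Partrec.rfind ?_) ?_
    · exact (Computable.partrec ((primrec_urun_halted.comp
        ((Primrec.const D).pair (Primrec.pair Primrec.fst Primrec.snd))).to_comp)).of_eq
        fun p => rfl
    · exact (primrec_outBits_urun_steps.comp
        ((Primrec.const D).pair (Primrec.pair Primrec.fst Primrec.snd))).to_comp
  · intro w y m h
    obtain ⟨h1, h2⟩ := TM2Std.outputs_tr T.tm h
    obtain ⟨⟨⟨N, hev⟩, hle⟩⟩ := h1
    simp only [Option.map_some] at hev
    -- `N` is the halting time found by the search
    have hN : N ∈ Nat.rfind fun n => Part.some (!(urun D.prog (initCfg D w) n).1.isSome) := by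
      refine Nat.mem_rfind.2 ⟨?_, fun {n} hn => ?_⟩
      · rw [Part.mem_some_iff, hD, urun_initCfg_fst_eq_none T 0 0 w hev]
        rfl
      · rw [Part.mem_some_iff, hD, urun_initCfg_fst_isSome_of_lt T 0 0 w hev hn]
        rfl
    change y ∈ Part.map (fun n => outBits D (urun D.prog (initCfg D w) n))
      (Nat.rfind fun n => Part.some (!(urun D.prog (initCfg D w) n).1.isSome))
    rw [Part.eq_some_iff.2 hN, Part.map_some, Part.mem_some_iff]
    -- the machine outputs `y` within `N` steps
    have hout : Nonempty (TM2OutputsInTime (TM2Std.stdCode T.tm).tm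
        (TM2Std.stkCode T.tm T.tm.k₀ (w.map T.inputAlphabet.symm))
        (some (TM2Std.stkCode T.tm T.tm.k₁ (y.map T.outputAlphabet.symm))) N) :=
      ⟨⟨⟨N, by simpa using hev⟩, le_rfl⟩⟩
    -- rerun the output computation of `outBits_urun_idxOf_of_le` at the standard-machine level
    have key := urun_of_outputsInTime (TM2Std.stdCode T.tm) hout le_rfl
    have hin : (TM2Std.stkCode T.tm T.tm.k₀ (w.map T.inputAlphabet.symm)).map Fin.val =
        w.map (inpCode D.io) := by
      simp only [TM2Std.stkCode, List.map_map]
      refine List.map_congr_left fun b _ => ?_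
      cases b <;> rfl
    symm
    change outBits D (urun (encProg (TM2Std.stdCode T.tm))
      (some ((TM2Std.stdCode T.tm).main : ℕ), ((TM2Std.stdCode T.tm).init : ℕ),
        (List.replicate (TM2Std.stdCode T.tm).nK []).set (TM2Std.stdCode T.tm).k₀
          (w.map (inpCode D.io))) N) = y
    rw [← hin, key]
    unfold outBits
    change (((List.replicate (TM2Std.stdCode T.tm).nK ([] : List ℕ)).set (TM2Std.stdCode T.tm).k₁
        ((TM2Std.stkCode T.tm T.tm.k₁ (y.map T.outputAlphabet.symm)).map Fin.val)).getD
          (TM2Std.stdCode T.tm).k₁ []).map (fun j => D.outTab.getD j false) = y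
    rw [getD_set_replicate]
    simp only [TM2Std.stkCode, List.map_map]
    conv_rhs => rw [← List.map_id y]
    refine List.map_congr_left fun b hb => ?_
    have hallowed := h2 (T.outputAlphabet.symm b) (List.mem_map.2 ⟨b, hb, rfl⟩)
    change (List.ofFn fun j : Fin (TM2Std.stdN T.tm + 1) =>
        ((TM2Std.decOpt T.tm T.tm.k₁ (some j)).map T.outputAlphabet).getD false).getD
          (TM2Std.enc T.tm ⟨T.tm.k₁, T.outputAlphabet.symm b⟩ : ℕ) false = b
    rw [getD_ofFn, TM2Std.decOpt_enc T.tm hallowed]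
    simp

end UnivTM2

/-! ### Time-bounded computability implies partial recursiveness -/

section Bridge

open _root_.Computability

variable {α β : Type}

/-- **Machine-computable functions are partial recursive on codes**, whatever the time bound:
if `f : α → β` is computed by a `TM2` machine within `t n` steps (Boolean encoders `ea`, `eb`;
`t` arbitrary, possibly non-recursive), then some partial recursive `F : List Bool →. List Bool`
has `eb (f a) ∈ F (ea a)` for all `a`. [cite: AroraBarakCC2009, §1.4 (Thm. 1.9, universal simulation)] -/
theorem TimeComputable.exists_partrec {ea : α → List Bool} {eb : β → List Bool} {f : α → β}
    {t : ℕ → ℕ} (hf : TimeComputable ea eb f t) :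
    ∃ F : List Bool →. List Bool, Partrec F ∧ ∀ a, eb (f a) ∈ F (ea a) := by
  obtain ⟨T, hT⟩ := hf
  obtain ⟨F, hF, hFT⟩ := UnivTM2.exists_partrec_run T
  exact ⟨F, hF, fun a => hFT _ _ _ (hT a)⟩

/-- With a computable input coding (on a `Primcodable` type), the output code `a ↦ eb (f a)` of
a machine-computable `f` is `Computable` (total, since the machine halts on every input).
[cite: AroraBarakCC2009, §1.4 (Thm. 1.9, universal simulation)] -/
theorem TimeComputable.computable_encode [Primcodable α] {ea : α → List Bool} {eb : β → List Bool}
    {f : α → β} {t : ℕ → ℕ} (hf : TimeComputable ea eb f t) (hea : Computable ea) :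
    Computable fun a => eb (f a) := by
  obtain ⟨F, hF, hFf⟩ := hf.exists_partrec
  exact Partrec.of_eq_tot (hF.comp hea) fun a => hFf a

end Bridge

/-! ### `DTIME`, `P` and `NP` languages are decidable predicates -/

section Decidable

open _root_.Computability

/-- **Time-decidable languages are decidable predicates**: `TimeDecidable id L t` (any `t`)
gives `ComputablePred (· ∈ L)` — the indicator bit is read off the partial recursive simulation.
[cite: Sipser2012, Def. 7.7 (time complexity classes consist of languages decided by deciders)] [cite: AroraBarakCC2009, §1.4 (Thm. 1.9)] -/
theorem TimeDecidable.computablePred_mem {L : Language Bool} {t : ℕ → ℕ}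
    (h : TimeDecidable (id : List Bool → List Bool) L t) : ComputablePred (· ∈ L) := by
  have hc : Computable fun w : List Bool => encodeBool (L.boolIndicator w) :=
    TimeComputable.computable_encode (timeDecidable_iff.1 h) Computable.id
  have hb : Computable fun w : List Bool => L.boolIndicator w :=
    ((Primrec.list_headI.to_comp).comp hc).of_eq fun w => rfl
  exact ComputablePred.computable_iff.2 ⟨_, hb, funext fun w => propext (Set.mem_iff_boolIndicator L w)⟩

/-- **`DTIME t` languages are decidable predicates.** [cite: AroraBarakCC2009, Def. 1.13 and §1.4 (Thm. 1.9)] -/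
theorem computablePred_mem_of_mem_DTIME {L : Language Bool} {t : ℕ → ℕ} (h : L ∈ DTIME t) :
    ComputablePred (· ∈ L) := by
  obtain ⟨c, hc⟩ := h
  simp only [TimeClass, Set.mem_setOf_eq] at hc
  exact TimeDecidable.computablePred_mem hc

/-- **`P` languages are decidable predicates.** [cite: Sipser2012, Def. 7.12 (P is a class of decidable languages)] [cite: AroraBarakCC2009, Def. 1.13] -/
theorem computablePred_mem_of_mem_P {L : Language Bool} (h : L ∈ Classes.P) :
    ComputablePred (· ∈ L) := by
  obtain ⟨k, hk⟩ := Set.mem_iUnion.1 h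
  exact computablePred_mem_of_mem_DTIME hk

/-- Evaluation of a fixed polynomial over `ℕ` is primitive recursive. [folklore] -/
private theorem primrec_polynomial_eval (p : Polynomial ℕ) : Primrec fun n : ℕ => p.eval n := by
  induction p using Polynomial.induction_on' with
  | add p q hp hq =>
    simpa only [Polynomial.eval_add] using Primrec.nat_add.comp hp hq
  | monomial k a =>
    simp only [Polynomial.eval_monomial]
    exact Primrec.nat_mul.comp (Primrec.const a)
      ((Primrec₂.unpaired'.1 Nat.Primrec.pow).comp Primrec.id (Primrec.const k))

/-- All Boolean strings of length exactly `k`, as an iterate: primitive recursive in `k`. [folklore] -/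
private theorem primrec_allOfLen : Primrec fun k : ℕ =>
    (fun L : List (List Bool) => L.flatMap fun l => [false :: l, true :: l])^[k] [[]] := by
  have hg : Primrec (fun q : (ℕ × List (List Bool)) × List Bool => [false :: q.2, true :: q.2]) :=
    Primrec.list_cons.comp (Primrec.list_cons.comp (Primrec.const false) Primrec.snd)
      (Primrec.list_cons.comp (Primrec.list_cons.comp (Primrec.const true) Primrec.snd)
        (Primrec.const []))
  have hstep : Primrec (fun q : ℕ × List (List Bool) => q.2.flatMap fun l => [false :: l, true :: l]) :=
    Primrec.list_flatMap Primrec.snd hg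
  exact Primrec.nat_iterate Primrec.id (Primrec.const [[]]) hstep

/-- Every string of length `k` is listed by the `k`-th iterate. [folklore] -/
private theorem mem_allOfLen : ∀ (k : ℕ) (y : List Bool), y.length = k →
    y ∈ (fun L : List (List Bool) => L.flatMap fun l => [false :: l, true :: l])^[k] [[]]
  | 0, y, hy => by simp [List.length_eq_zero_iff.1 hy]
  | k + 1, y, hy => by
    obtain ⟨b, l, rfl⟩ := List.exists_cons_of_length_eq_add_one hy
    rw [Function.iterate_succ_apply', List.mem_flatMap]
    refine ⟨l, mem_allOfLen k l (by simpa using hy), ?_⟩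
    cases b <;> simp

/-- **`NP` languages are decidable predicates**: with `L' ∈ P` and the certificate bound `p`,
`x ∈ L` iff some `y` with `|y| ≤ p(|x|)` has `⟨x, y⟩ ∈ L'`; enumerate the finitely many
candidates and run the (primitive recursive, `PolyTimeComputable.primrec_encode`) decider of `L'`.
[cite: AroraBarakCC2009, Claim 2.4 (proof: enumerate all certificates `u`)] [cite: Sipser2012, §7.3 (NP ⊆ EXPTIME: NP languages are decidable)] -/
theorem computablePred_mem_of_mem_NP {L : Language Bool} (h : L ∈ Nondeterministic.NP) :
    ComputablePred (· ∈ L) := by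
  obtain ⟨L', hL', p, hp⟩ := h
  -- the decider of `L'` is primitive recursive on codes
  have hdec : Primrec fun w : List Bool => encodeBool (L'.boolIndicator w) :=
    (polyTimeDecidable_iff.1 (mem_P_iff_holds.1 hL')).primrec_encode Primrec.id
  have hind : Primrec fun w : List Bool => L'.boolIndicator w :=
    (Primrec.list_headI.comp hdec).of_eq fun w => rfl
  -- the candidate certificates: all strings of length `≤ p |x|`
  set cands : List Bool → List (List Bool) := fun x =>
    (List.range (p.eval x.length + 1)).flatMap fun k =>
      (fun L : List (List Bool) => L.flatMap fun l => [false :: l, true :: l])^[k] [[]] with hcands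
  have hcands_prim : Primrec cands :=
    Primrec.list_flatMap (Primrec.list_range.comp (Primrec.succ.comp
      ((primrec_polynomial_eval p).comp Primrec.list_length)))
      (primrec_allOfLen.comp Primrec.snd).to₂
  have hmem_cands : ∀ x y, y.length ≤ p.eval x.length → y ∈ cands x := by
    intro x y hy
    rw [hcands, List.mem_flatMap]
    exact ⟨y.length, List.mem_range.2 (Nat.lt_succ_of_le hy), mem_allOfLen _ _ rfl⟩
  -- the decision procedure: does some candidate of admissible length verify?
  set dec : List Bool → Bool := fun x =>
    (cands x).foldr (fun y b => if y.length ≤ p.eval x.length then L'.boolIndicator (boolPair x y) || b else b)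
      false with hdecf
  have hdec_prim : Primrec dec := by
    have hlen : PrimrecPred fun q : List Bool × (List Bool × Bool) => q.2.1.length ≤ p.eval q.1.length :=
      PrimrecRel.comp Primrec.nat_le (Primrec.list_length.comp (Primrec.fst.comp Primrec.snd))
        ((primrec_polynomial_eval p).comp (Primrec.list_length.comp Primrec.fst))
    have hver : Primrec fun q : List Bool × (List Bool × Bool) => L'.boolIndicator (boolPair q.1 q.2.1) :=
      hind.comp (UnivTM2.primrec_boolPair.comp Primrec.fst (Primrec.fst.comp Primrec.snd))
    have hh : Primrec fun q : List Bool × (List Bool × Bool) =>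
        if q.2.1.length ≤ p.eval q.1.length then L'.boolIndicator (boolPair q.1 q.2.1) || q.2.2 else q.2.2 :=
      Primrec.ite hlen (Primrec.or.comp hver (Primrec.snd.comp Primrec.snd)) (Primrec.snd.comp Primrec.snd)
    have H := Primrec.list_foldr hcands_prim (Primrec.const false)
      (h := fun (x : List Bool) (q : List Bool × Bool) =>
        if q.1.length ≤ p.eval x.length then L'.boolIndicator (boolPair x q.1) || q.2 else q.2) hh
    exact H.of_eq fun x => rfl
  have hfold : ∀ (x : List Bool) (l : List (List Bool)),
      l.foldr (fun y b => if y.length ≤ p.eval x.length then L'.boolIndicator (boolPair x y) || b else b)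
        false = true ↔ ∃ y ∈ l, y.length ≤ p.eval x.length ∧ boolPair x y ∈ L' := by
    intro x l
    induction l with
    | nil => simp
    | cons y l ih =>
      rw [List.foldr_cons]
      by_cases hy : y.length ≤ p.eval x.length
      · rw [if_pos hy, Bool.or_eq_true, ih, ← Set.mem_iff_boolIndicator]
        constructor
        · rintro (hyL | ⟨z, hz, hz'⟩)
          · exact ⟨y, by simp, hy, hyL⟩
          · exact ⟨z, List.mem_cons_of_mem _ hz, hz'⟩
        · rintro ⟨z, hz, hz'⟩
          rcases List.mem_cons.1 hz with rfl | hz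
          · exact Or.inl hz'.2
          · exact Or.inr ⟨z, hz, hz'⟩
      · rw [if_neg hy, ih]
        constructor
        · rintro ⟨z, hz, hz'⟩
          exact ⟨z, List.mem_cons_of_mem _ hz, hz'⟩
        · rintro ⟨z, hz, hz'⟩
          rcases List.mem_cons.1 hz with rfl | hz
          · exact absurd hz'.1 hy
          · exact ⟨z, hz, hz'⟩
  refine ComputablePred.computable_iff.2 ⟨dec, hdec_prim.to_comp, funext fun x => propext ?_⟩
  rw [hp x, hdecf, hfold]
  constructor
  · rintro ⟨y, hy, hyL⟩
    exact ⟨y, hmem_cands x y hy, hy, hyL⟩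
  · rintro ⟨y, -, hy, hyL⟩
    exact ⟨y, hy, hyL⟩

end Decidable

end Literature.Computability.Complexity
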